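import Literature.Geometry.Kaehler.ComplexTorusPicardNumbersSmallDimension
import Mathlib.NumberTheory.Transcendental.Liouville.LiouvilleNumber
import Mathlib.RingTheory.Algebraic.Basic
import HarnessLib

/-!
# An abelian variety of Picard number one in every dimension; `{1, …, 2g} ⊆ R_g` (Hulek–Laface 2019,
# Prop. 6.4) and `R_3 = {1, …, 6, 9}` as printed

Layer `Literature/Geometry/Kaehler`, namespace `Literature.Geometry.Kaehler.ComplexTorus`; lane
`lit-hodgefound`, Layer A4 (row A4-13, the Picard-number lineage Q51 / Q597 / Q632 of
`run/shared/lean/pub/lit-hodgefound/SKELETON.md`).  Sequel of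
`ComplexTorusPicardNumbersSmallDimension.lean` (an explicit abelian SURFACE of Picard number one,
`R_2 = {1, 2, 3, 4}`, and `{2, …, 6, 9} ⊆ R_3 ⊆ {1, …, 6, 9}` — "Not covered: `1 ∈ R_g` for `g ≥ 3`
(Prop. 6.4, a very general abelian variety)") and of `ComplexTorusNeronSeveriPeriodMatrix.lean`
(Lange's Exercise 1.3.4 (9): `NS(ℂ^g/(Zℤ^g ⊕ ℤ^g)) ≅ nsMatrices Z`, the antisymmetric integer matrices
`(A B; -ᵗB C)` with `A - BZ + ᵗZᵗB + ᵗZCZ = 0`).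

Sources (held texts; quotations verbatim):

* [HulekLaface2019PicardNumbersAV] K. Hulek, R. Laface, *On the Picard numbers of abelian varieties*,
  Ann. Sc. Norm. Super. Pisa (5) XIX (2019) (arXiv:1703.05882), §6.2 **Proposition 6.4**: "Given `g ≥ 2`,
  consider the set `R_g` of Picard numbers of abelian varieties of dimension `g`. Then,
  `{1, …, 2g} ⊂ R_g`." (proof: "As `R_2 = {1, …, 4}` is complete and `R_3 ⊃ {1, …, 6}`, the result
  easily follows by induction on `g`"; the value `1` is the case "`F = End_ℚ(X) ≅ ℚ`. The ppav of this
  type are given by removing from `𝒜_g` a countable union of proper Shimura varieties" of the proof of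
  Prop. 6.3); §1: "In fact, it is not hard to show that `R_3 = {1, …, 6, 9}`: indeed, a very general
  abelian threefold has Picard number `ρ = 1`; a product `S × E`, `S` being a very general abelian
  surface and `E` being an elliptic curve, has Picard number `ρ = 2`; all other Picard numbers can be
  obtained by using suitable products of elliptic curves"; §7.2 Thm. 7.4 (the boxes
  `R_{g,k} = (g−k)² + R_k`).
* [Lange2023AbelianVarietiesComplex] H. Lange, *Abelian Varieties over the Complex Numbers* (2023),
  §1.3 Exercise 1.3.4 (9) (`NS(X)` through the period matrix `(Z, 1_g)`: "(ii) `A, B, C ∈ M_g(ℤ)` with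
  `A - BZ + ᵗZᵗB + ᵗZCZ = 0`"), §5.1.5 Exercise (3) (the tori with period matrix `(iY, 1₂)`,
  `Y ∈ M₂(ℝ)`: "Use Exercise 1.3.4 (9) to show that the Picard number of `X` is …"), §3.1 Prop. 3.1.1
  (`(Z, 1_g)` with `Z = ᵗZ`, `Im Z > 0` is the period matrix of an abelian variety).

## What is proved (theorems and four definitions with bodies; NO named fact, net debt 0)

The printed sources assert the EXISTENCE of abelian varieties of Picard number one in every dimension
through a Baire-category / moduli argument ("very general").  This file supplies an EXPLICIT witness in
every dimension `g ≥ 1` and derives the printed statements from it: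

* §1–§2 (arithmetic of the exponents, [folklore] plumbing kept private where generic) and §3
  (`picardOnePolyMatrix`, coefficient extraction): for the SYMMETRIC matrix of exponents
  `e(a, b) = 3^{min(a,b) + g·max(a,b)}` (`picardOneExponent`; pairwise distinct on unordered pairs, and
  sums of two of them are never a single one and determine the two summands — base-`3` digits), the
  polynomial matrix `𝒴(X) = N·1_g + (X^{e(a,b)})_{a,b} ∈ M_g(ℤ[X])` satisfies: if `𝒜 = 𝒴𝒞𝒴` with
  `𝒜, 𝒞` constant then `𝒞 = 0` (`eq_zero_of_map_C_eq_picardOnePolyMatrix_mul_mul`, reading the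
  coefficient of `X^{e(j,l) + e(m,k)}` in the entry `(j, k)`, `j ≠ k`), and if `ℬ𝒴 = 𝒴ᵗℬ` with `ℬ`
  constant then `ℬ` is scalar (`scalar_of_map_C_mul_picardOnePolyMatrix_eq`, coefficient of `X^{e(l,k)}`).
* §4 (`picardOneMatrix n N t = N·1 + (t^{e(a,b)}) ∈ M_g(ℝ)`): for `t` TRANSCENDENTAL (over `ℤ`) the
  evaluation `ℤ[X] → ℝ`, `X ↦ t` is injective, so the same conclusions hold for real equations
  `A = YCY`, `BY = YᵗB` with `A, B, C` integer matrices and `Y = picardOneMatrix g N t`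
  (`eq_zero_and_eq_zero_of_eq_picardOneMatrix_mul_mul`, `scalar_of_mul_picardOneMatrix_eq`).
* §5 **Exercise 1.3.4 (9) at a purely imaginary period matrix** `Z = iY`, `Y = ᵗY` real, ANY `g`
  (the route printed for `g = 2` in Exercise 5.1.5 (3)(a)): condition (ii) splits into its real and
  imaginary parts, `(A − YCY) + i(YᵗB − BY) = 0` (`nsRelation_I_smul_of_transpose_eq_neg`), whence
  **`mem_nsMatrices_I_smul_iff`**: `G = (A B; -ᵗB C) ∈ nsMatrices (iY)` iff `G` is antisymmetric with
  `A = YCY` and `BY = YᵗB`.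
* §6 **`NS = ℤ·E₀`**: for `t` transcendental and any `N ∈ ℤ`,
  **`mem_nsMatrices_picardOneMatrix_iff`**: `nsMatrices (i·picardOneMatrix g N t) = ℤ · (0 1; −1 0)`
  (so `finrank_nsMatrices_picardOneMatrix : rank = 1` for `g ≥ 1`, and
  `finrank_neronSeveriGroup_periodIsoOfNormalForm_picardOneMatrix`: the complex torus
  `ℂ^g/(iYℤ^g ⊕ ℤ^g)` has Picard number `1` whenever `det Y ≠ 0`).
* §7 **The explicit abelian variety `X_g^L`**: `t = ℓ := liouvilleNumber 3 = Σ_k 3^{-k!}` (Liouville's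
  constant to base `3`, transcendental by Mathlib's `transcendental_liouvilleNumber`; `0 < ℓ < 1`) and
  `N = g + 1`: `liouvillePeriodMatrix g = (g+1)·1 + (ℓ^{e(a,b)})` is symmetric POSITIVE DEFINITE
  (`posDef_picardOneMatrix`: `ᵗxYx ≥ (N − g)|x|²` for `0 ≤ t ≤ 1`), so `iY` lies in Siegel's upper half
  space and `liouvillePeriod g := periodIsoOfNormalForm (iY)` presents an ABELIAN VARIETY
  (`isAbelianVariety_liouvillePeriod`, Prop. 3.1.1 via the tree's
  `isAbelianVariety_periodIsoOfNormalForm_of_posDef`) of dimension `g` with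
  **`finrank_neronSeveriGroup_liouvillePeriod : ρ(X_g^L) = 1`**.
* §8 **The printed statements**: `one_mem_picardNumbers : 1 ∈ R_g` (`g ≥ 1`);
  `Icc_one_subset_picardNumbers : {1, …, g} ⊆ R_g` (adding non-isogenous CM elliptic factors one at a
  time, the tree's `sq_add_mem_picardNumbers_of_mem`); **`Icc_one_two_mul_subset_picardNumbers`:
  `{1, …, 2g} ⊆ R_g` for `g ≥ 2` — Prop. 6.4 AS PRINTED** (the range `[g, 2g]` is the tree's Remark 6.5,
  `exists_abelianVariety_finrank_eq_and_finrank_neronSeveriGroup_eq`); **`picardNumbers_three :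
  R_3 = {1, …, 6, 9}` AS PRINTED** (§1); the third box of Thm. 7.4 as an equality of sets
  (`picardNumbers_inter_Ioc_thirdBox_eq`, `g ≥ 12`), the top of `R_g` made fully explicit
  (`picardNumbers_inter_Icc_eq_boxes_explicit`), and the first member `(g−k)² + 1` of every box
  (`sq_add_one_mem_picardNumbers_add`).

Design: the witness is stated for an arbitrary transcendental `t` and integer `N` (§6), the Liouville
constant being one admissible choice (§7); the exponents are powers of `3` so that the needed
independence of the monomials `1, t^{e}, t^{e+e'}` is the injectivity of `ℤ[X] → ℝ` plus base-`3`
arithmetic — no algebraic-independence theory is used.  Not covered: `End(X_g^L) = ℤ` / simplicity of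
`X_g^L` (the same coefficient argument applies to `δY = Yα`, `β = 0 = γ`; not needed for Prop. 6.4), and
the moduli-theoretic form "a very general ppav has `ρ = 1`" (a statement about `𝒜_g`, outside the
tree's vocabulary).

## References

* [HulekLaface2019PicardNumbersAV] K. Hulek, R. Laface, *On the Picard numbers of abelian varieties*,
  Ann. Sc. Norm. Super. Pisa Cl. Sci. (5) XIX (2019) 1199–1224 (arXiv:1703.05882), §1, §6.2 Prop. 6.3,
  Prop. 6.4, Remark 6.5, §7.2 Thm. 7.4.
* [Lange2023AbelianVarietiesComplex] H. Lange, *Abelian Varieties over the Complex Numbers*, Grundlehren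
  Text Edition, Springer (2023), §1.3 Exercise 1.3.4 (9), §3.1 Prop. 3.1.1, §5.1.5 Exercise (3).
* [LangeBirkenhake1992] H. Lange, Ch. Birkenhake, *Complex Abelian Varieties*, Springer (1992), Exercise
  1.6 (9), §8.1 Prop. 8.1.1 (the same statements in the original volume).
-/

noncomputable section

open Module Matrix Polynomial
open Complex (I ofReal)

namespace Literature.Geometry.Kaehler

namespace ComplexTorus

/-! ## §1 Base-`3` arithmetic -/

section Arithmetic

/-- `3^a = 3^b ↔ a = b`. [folklore] -/
private theorem three_pow_eq_iff {a b : ℕ} : 3 ^ a = 3 ^ b ↔ a = b :=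
  (Nat.pow_right_injective (by norm_num : 2 ≤ 3)).eq_iff

/-- `3^p + 3^q = 3^{p'} + 3^{q'}` with `p ≤ q`, `p' ≤ q'` forces `p = p'`, `q = q'` (base-`3` digits).
[folklore] -/
private theorem three_pow_add_eq_aux {p q p' q' : ℕ} (hpq : p ≤ q) (hpq' : p' ≤ q')
    (h : 3 ^ p + 3 ^ q = 3 ^ p' + 3 ^ q') : p = p' ∧ q = q' := by
  have key : ∀ {p q p' q' : ℕ}, p ≤ q → p' ≤ q' → 3 ^ p + 3 ^ q = 3 ^ p' + 3 ^ q' → q ≤ q' := by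
    intro p q p' q' hpq hpq' h
    by_contra hlt
    rw [not_le] at hlt
    have h1 : 3 ^ p' ≤ 3 ^ q' := Nat.pow_le_pow_right (by norm_num) hpq'
    have h2 : 3 ^ (q' + 1) ≤ 3 ^ q := Nat.pow_le_pow_right (by norm_num) hlt
    have h3 : 3 ^ (q' + 1) = 3 * 3 ^ q' := by ring
    have h4 : 0 < 3 ^ p := Nat.pos_of_ne_zero (pow_ne_zero _ (by norm_num))
    omega
  have hq : q = q' := le_antisymm (key hpq hpq' h) (key hpq' hpq h.symm)
  subst hq
  refine ⟨three_pow_eq_iff.1 ?_, rfl⟩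
  simpa using h

/-- `3^p + 3^q = 3^{p'} + 3^{q'} ↔ {p, q} = {p', q'}`. [folklore] -/
private theorem three_pow_add_eq_iff {p q p' q' : ℕ} :
    3 ^ p + 3 ^ q = 3 ^ p' + 3 ^ q' ↔ (p = p' ∧ q = q') ∨ (p = q' ∧ q = p') := by
  constructor
  · intro h
    rcases le_total p q with hpq | hpq <;> rcases le_total p' q' with hpq' | hpq'
    · exact Or.inl (three_pow_add_eq_aux hpq hpq' h)
    · have := three_pow_add_eq_aux hpq hpq' (by rw [h, add_comm])
      exact Or.inr this
    · have := three_pow_add_eq_aux hpq hpq' (by rw [add_comm, h])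
      exact Or.inr ⟨this.2, this.1⟩
    · have := three_pow_add_eq_aux hpq hpq' (by rw [add_comm, h, add_comm])
      exact Or.inl ⟨this.2, this.1⟩
  · rintro (⟨rfl, rfl⟩ | ⟨rfl, rfl⟩)
    · rfl
    · exact add_comm _ _

/-- `3^p + 3^q` is never a power of `3`. [folklore] -/
private theorem three_pow_add_ne_three_pow (p q r : ℕ) : 3 ^ p + 3 ^ q ≠ 3 ^ r := by
  intro h
  wlog hpq : p ≤ q generalizing p q
  · exact this q p (by rw [add_comm, h]) (not_le.mp hpq).le
  rcases le_or_gt r q with hr | hr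
  · have h1 : 3 ^ r ≤ 3 ^ q := Nat.pow_le_pow_right (by norm_num) hr
    have h4 : 0 < 3 ^ p := Nat.pos_of_ne_zero (pow_ne_zero _ (by norm_num))
    omega
  · have h1 : 3 ^ p ≤ 3 ^ q := Nat.pow_le_pow_right (by norm_num) hpq
    have h2 : 3 ^ (q + 1) ≤ 3 ^ r := Nat.pow_le_pow_right (by norm_num) hr
    have h3 : 3 ^ (q + 1) = 3 * 3 ^ q := by ring
    have h4 : 0 < 3 ^ p := Nat.pos_of_ne_zero (pow_ne_zero _ (by norm_num))
    omega

end Arithmetic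

/-! ## §2 The symmetric matrix of exponents `e(a, b) = 3^{min(a,b) + g·max(a,b)}` -/

section Exponent

/-- The code `min(a, b) + g·max(a, b) ∈ ℕ` of the unordered pair `{a, b} ⊆ {0, …, g−1}` (injective on
unordered pairs, `picardOnePairIndex_eq_iff`) — the base-`3` logarithm of the exponent `e(a, b)` of the
explicit period matrix `Y = N·1 + (t^{e(a,b)})` of this file's abelian variety of Picard number one.
[cite: HulekLaface2019PicardNumbersAV, §6.2 Prop. 6.4 (existence of an abelian variety of Picard number `1` in every dimension; the explicit witness is this file's)] -/
def picardOnePairIndex (n : ℕ) (a b : Fin n) : ℕ := min (a : ℕ) b + n * max (a : ℕ) b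

/-- `picardOnePairIndex` is symmetric. [cite: HulekLaface2019PicardNumbersAV, §6.2 Prop. 6.4 (explicit witness, this file)] -/
theorem picardOnePairIndex_comm (n : ℕ) (a b : Fin n) :
    picardOnePairIndex n a b = picardOnePairIndex n b a := by
  simp only [picardOnePairIndex, min_comm, max_comm]

/-- `picardOnePairIndex` is injective on unordered pairs: `code(a, b) = code(c, d) ↔ {a, b} = {c, d}`
(`min` is the remainder and `max` the quotient modulo `g`). [cite: HulekLaface2019PicardNumbersAV, §6.2 Prop. 6.4 (explicit witness, this file)] -/
theorem picardOnePairIndex_eq_iff {n : ℕ} {a b c d : Fin n} :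
    picardOnePairIndex n a b = picardOnePairIndex n c d ↔ (a = c ∧ b = d) ∨ (a = d ∧ b = c) := by
  constructor
  · intro h
    have hmin : min (a : ℕ) b = min (c : ℕ) d := by
      have h1 := congrArg (· % n) h
      simp only [picardOnePairIndex] at h1
      have ha : min (a : ℕ) b < n := (min_le_left _ _).trans_lt a.2
      have hc : min (c : ℕ) d < n := (min_le_left _ _).trans_lt c.2
      rwa [Nat.add_mul_mod_self_left, Nat.add_mul_mod_self_left, Nat.mod_eq_of_lt ha,
        Nat.mod_eq_of_lt hc] at h1
    have hmax : max (a : ℕ) b = max (c : ℕ) d := by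
      have hn : 0 < n := a.pos
      have h1 : n * max (a : ℕ) b = n * max (c : ℕ) d := by
        have := h; simp only [picardOnePairIndex] at this; omega
      exact Nat.eq_of_mul_eq_mul_left hn h1
    simp only [Fin.ext_iff]
    omega
  · rintro (⟨rfl, rfl⟩ | ⟨rfl, rfl⟩)
    · rfl
    · exact picardOnePairIndex_comm n a b

/-- **The exponents `e(a, b) = 3^{code(a,b)}`** of the explicit period matrix `Y = N·1 + (t^{e(a,b)})`.
[cite: HulekLaface2019PicardNumbersAV, §6.2 Prop. 6.4 (explicit witness, this file)] -/
def picardOneExponent (n : ℕ) (a b : Fin n) : ℕ := 3 ^ picardOnePairIndex n a b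

/-- `e(a, b) = e(b, a)` (so `Y` is symmetric). [cite: HulekLaface2019PicardNumbersAV, §6.2 Prop. 6.4 (explicit witness, this file)] -/
theorem picardOneExponent_comm (n : ℕ) (a b : Fin n) :
    picardOneExponent n a b = picardOneExponent n b a := by
  rw [picardOneExponent, picardOneExponent, picardOnePairIndex_comm]

/-- `e(a, b) ≠ 0` (no exponent is the constant term). [cite: HulekLaface2019PicardNumbersAV, §6.2 Prop. 6.4 (explicit witness, this file)] -/
theorem picardOneExponent_ne_zero (n : ℕ) (a b : Fin n) : picardOneExponent n a b ≠ 0 :=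
  pow_ne_zero _ (by norm_num)

/-- `e(a, b) = e(c, d) ↔ {a, b} = {c, d}`. [cite: HulekLaface2019PicardNumbersAV, §6.2 Prop. 6.4 (explicit witness, this file)] -/
theorem picardOneExponent_eq_iff {n : ℕ} {a b c d : Fin n} :
    picardOneExponent n a b = picardOneExponent n c d ↔ (a = c ∧ b = d) ∨ (a = d ∧ b = c) := by
  rw [picardOneExponent, picardOneExponent, three_pow_eq_iff, picardOnePairIndex_eq_iff]

/-- `e(a, b) = e(c, b) ↔ a = c`. [cite: HulekLaface2019PicardNumbersAV, §6.2 Prop. 6.4 (explicit witness, this file)] -/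
theorem picardOneExponent_eq_iff_left {n : ℕ} {a c b : Fin n} :
    picardOneExponent n a b = picardOneExponent n c b ↔ a = c := by
  rw [picardOneExponent_eq_iff]
  constructor
  · rintro (⟨h, -⟩ | ⟨h1, h2⟩)
    · exact h
    · exact h1.trans h2
  · exact fun h ↦ Or.inl ⟨h, rfl⟩

/-- A sum of two exponents is never an exponent (a number with two base-`3` digits `1`, or one digit
`2`, is not a power of `3`). [cite: HulekLaface2019PicardNumbersAV, §6.2 Prop. 6.4 (explicit witness, this file)] -/
theorem picardOneExponent_add_ne (n : ℕ) (a b c d x y : Fin n) :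
    picardOneExponent n a b + picardOneExponent n c d ≠ picardOneExponent n x y :=
  three_pow_add_ne_three_pow _ _ _

/-- A sum of two exponents determines its two summands. [cite: HulekLaface2019PicardNumbersAV, §6.2 Prop. 6.4 (explicit witness, this file)] -/
theorem picardOneExponent_add_eq_add_iff {n : ℕ} {a b c d a' b' c' d' : Fin n} :
    picardOneExponent n a b + picardOneExponent n c d =
        picardOneExponent n a' b' + picardOneExponent n c' d' ↔
      (picardOneExponent n a b = picardOneExponent n a' b' ∧
          picardOneExponent n c d = picardOneExponent n c' d') ∨
        (picardOneExponent n a b = picardOneExponent n c' d' ∧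
          picardOneExponent n c d = picardOneExponent n a' b') := by
  simp only [picardOneExponent, three_pow_add_eq_iff, three_pow_eq_iff]

/-- **The combinatorial heart**: for `j ≠ k` the exponent `e(j, l) + e(m, k)` (the degree in `X` of the
contribution of `C_{lm}` to the entry `(j, k)` of `𝒴𝒞𝒴`) determines `(l, m)`.
[cite: HulekLaface2019PicardNumbersAV, §6.2 Prop. 6.4 (explicit witness, this file)] -/
theorem picardOneExponent_add_eq_add_iff_of_ne {n : ℕ} {j k l m l' m' : Fin n} (hjk : j ≠ k) :
    picardOneExponent n j l + picardOneExponent n m k =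
        picardOneExponent n j l' + picardOneExponent n m' k ↔ l = l' ∧ m = m' := by
  rw [picardOneExponent_add_eq_add_iff, picardOneExponent_eq_iff, picardOneExponent_eq_iff,
    picardOneExponent_eq_iff, picardOneExponent_eq_iff]
  constructor
  · rintro (⟨h1, h2⟩ | ⟨h1, h2⟩)
    · refine ⟨?_, ?_⟩
      · rcases h1 with ⟨-, h⟩ | ⟨rfl, rfl⟩ <;> [exact h; rfl]
      · rcases h2 with ⟨h, -⟩ | ⟨rfl, rfl⟩ <;> [exact h; rfl]
    · -- the swapped matching forces `(l, m) = (k, j) = (l', m')`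
      rcases h1 with ⟨hm', hl⟩ | ⟨hj, -⟩
      · rcases h2 with ⟨hm, hl'⟩ | ⟨-, hk⟩
        · exact ⟨hl.trans hl', hm.trans hm'⟩
        · exact absurd hk.symm hjk
      · exact absurd hj hjk
  · rintro ⟨rfl, rfl⟩
    exact Or.inl ⟨Or.inl ⟨rfl, rfl⟩, Or.inl ⟨rfl, rfl⟩⟩

end Exponent

/-! ## §3 The polynomial period matrix `𝒴(X) = N·1 + (X^{e(a,b)})` and coefficient extraction -/

section Poly

variable (n : ℕ) (N : ℤ)

/-- **`𝒴(X) ∈ M_g(ℤ[X])`, `𝒴(X)_{ab} = N δ_{ab} + X^{e(a,b)}`** — the period matrix `Y` of the witness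
with the transcendental number replaced by an indeterminate. [cite: HulekLaface2019PicardNumbersAV, §6.2 Prop. 6.4 (explicit witness, this file)] -/
def picardOnePolyMatrix : Matrix (Fin n) (Fin n) ℤ[X] :=
  of fun a b ↦ C (if a = b then N else 0) + X ^ picardOneExponent n a b

/-- Entries of `𝒴(X)`. [cite: HulekLaface2019PicardNumbersAV, §6.2 Prop. 6.4 (explicit witness, this file)] -/
theorem picardOnePolyMatrix_apply (a b : Fin n) :
    picardOnePolyMatrix n N a b = C (if a = b then N else 0) + X ^ picardOneExponent n a b :=
  rfl

/-- `coeff_d (c · (u + X^b)) = c·[d = b]` for `d ≠ 0`. [folklore] -/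
private theorem coeff_C_mul_entry (c u : ℤ) (b d : ℕ) (hd : d ≠ 0) :
    (C c * (C u + X ^ b)).coeff d = if d = b then c else 0 := by
  rw [mul_add, ← C_mul, coeff_add, coeff_C, if_neg hd, zero_add, coeff_C_mul_X_pow]

/-- `coeff_d ((u + X^a) · c) = c·[d = a]` for `d ≠ 0`. [folklore] -/
private theorem coeff_entry_mul_C (c u : ℤ) (a d : ℕ) (hd : d ≠ 0) :
    ((C u + X ^ a) * C c).coeff d = if d = a then c else 0 := by
  rw [mul_comm, coeff_C_mul_entry c u a d hd]

/-- `coeff_d ((u + X^a) · c · (v + X^b)) = c·[d = a + b]` for `d ∉ {0, a, b}`. [folklore] -/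
private theorem coeff_entry_mul_C_mul_entry (c u v : ℤ) (a b d : ℕ) (hd : d ≠ 0) (hda : d ≠ a)
    (hdb : d ≠ b) :
    ((C u + X ^ a) * C c * (C v + X ^ b)).coeff d = if d = a + b then c else 0 := by
  have h : (C u + X ^ a) * C c * (C v + X ^ b) =
      C (u * c * v) + C (u * c) * X ^ b + C (c * v) * X ^ a + C c * X ^ (a + b) := by
    simp only [C_mul, pow_add]; ring
  rw [h, coeff_add, coeff_add, coeff_add, coeff_C, if_neg hd, coeff_C_mul_X_pow, if_neg hdb,
    coeff_C_mul_X_pow, if_neg hda, coeff_C_mul_X_pow, zero_add, zero_add, zero_add]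

variable {n}

/-- **The top coefficient of `(𝒴𝒞𝒴)_{jk}`**: for a constant matrix `𝒞 = C`, `j ≠ k` and any `(l₀, m₀)`,
the coefficient of `X^{e(j,l₀) + e(m₀,k)}` in `(𝒴𝒞𝒴)_{jk}` is `C_{l₀m₀}`.
[cite: HulekLaface2019PicardNumbersAV, §6.2 Prop. 6.4 (explicit witness, this file)] -/
theorem coeff_picardOnePolyMatrix_mul_mul (C₀ : Matrix (Fin n) (Fin n) ℤ) {j k : Fin n} (hjk : j ≠ k)
    (l₀ m₀ : Fin n) :
    ((picardOnePolyMatrix n N * C₀.map C * picardOnePolyMatrix n N) j k).coeff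
        (picardOneExponent n j l₀ + picardOneExponent n m₀ k) = C₀ l₀ m₀ := by
  have hd0 : picardOneExponent n j l₀ + picardOneExponent n m₀ k ≠ 0 :=
    (Nat.add_pos_left (Nat.pos_of_ne_zero (picardOneExponent_ne_zero n j l₀)) _).ne'
  simp only [Matrix.mul_apply, Finset.sum_mul, finsetSum_coeff, Matrix.map_apply,
    picardOnePolyMatrix_apply]
  have hterm : ∀ m l : Fin n,
      ((C (if j = l then N else 0) + X ^ picardOneExponent n j l) * C (C₀ l m) *
          (C (if m = k then N else 0) + X ^ picardOneExponent n m k)).coeff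
          (picardOneExponent n j l₀ + picardOneExponent n m₀ k) =
        if l₀ = l then (if m₀ = m then C₀ l m else 0) else 0 := by
    intro m l
    rw [coeff_entry_mul_C_mul_entry _ _ _ _ _ _ hd0 (picardOneExponent_add_ne n _ _ _ _ _ _)
      (picardOneExponent_add_ne n _ _ _ _ _ _)]
    simp only [picardOneExponent_add_eq_add_iff_of_ne hjk, ite_and]
  simp_rw [hterm]
  simp only [Finset.sum_ite_eq, Finset.mem_univ, if_true]

/-- The coefficient of `X^{e(l₀,k)}` in `(ℬ𝒴)_{jk}` is `B_{jl₀}` (`ℬ = B` constant).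
[cite: HulekLaface2019PicardNumbersAV, §6.2 Prop. 6.4 (explicit witness, this file)] -/
theorem coeff_map_mul_picardOnePolyMatrix (B₀ : Matrix (Fin n) (Fin n) ℤ) (j k l₀ : Fin n) :
    ((B₀.map C * picardOnePolyMatrix n N) j k).coeff (picardOneExponent n l₀ k) = B₀ j l₀ := by
  simp only [Matrix.mul_apply, finsetSum_coeff, Matrix.map_apply, picardOnePolyMatrix_apply]
  have hterm : ∀ l : Fin n,
      (C (B₀ j l) * (C (if l = k then N else 0) + X ^ picardOneExponent n l k)).coeff
          (picardOneExponent n l₀ k) = if l₀ = l then B₀ j l else 0 := by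
    intro l
    rw [coeff_C_mul_entry _ _ _ _ (picardOneExponent_ne_zero n l₀ k)]
    simp only [picardOneExponent_eq_iff_left]
  simp_rw [hterm]
  simp only [Finset.sum_ite_eq, Finset.mem_univ, if_true]

/-- The coefficient of `X^{e(l₀,k)}` in `(𝒴ᵗℬ)_{jk}`, `j ≠ k`, is `B_{kk}·[l₀ = j]`.
[cite: HulekLaface2019PicardNumbersAV, §6.2 Prop. 6.4 (explicit witness, this file)] -/
theorem coeff_picardOnePolyMatrix_mul_map_transpose (B₀ : Matrix (Fin n) (Fin n) ℤ) {j k : Fin n}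
    (hjk : j ≠ k) (l₀ : Fin n) :
    ((picardOnePolyMatrix n N * (B₀.map C)ᵀ) j k).coeff (picardOneExponent n l₀ k) =
      if l₀ = j then B₀ k k else 0 := by
  simp only [Matrix.mul_apply, finsetSum_coeff, Matrix.map_apply, Matrix.transpose_apply,
    picardOnePolyMatrix_apply]
  have hterm : ∀ l : Fin n,
      ((C (if j = l then N else 0) + X ^ picardOneExponent n j l) * C (B₀ k l)).coeff
          (picardOneExponent n l₀ k) = if l₀ = j then (if k = l then B₀ k l else 0) else 0 := by
    intro l
    rw [coeff_entry_mul_C _ _ _ _ (picardOneExponent_ne_zero n l₀ k)]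
    have h : (l₀ = j ∧ k = l ∨ l₀ = l ∧ k = j) ↔ (l₀ = j ∧ k = l) :=
      ⟨fun h' ↦ h'.elim id fun h'' ↦ absurd h''.2.symm hjk, Or.inl⟩
    simp only [picardOneExponent_eq_iff, h, ite_and]
  simp_rw [hterm]
  by_cases h : l₀ = j
  · simp only [h, if_true, Finset.sum_ite_eq, Finset.mem_univ]
  · simp only [h, if_false, Finset.sum_const_zero]

/-- **From the identity `𝒜 = 𝒴𝒞𝒴` in `M_g(ℤ[X])` with `𝒜, 𝒞` constant (and `g ≥ 2`): `𝒞 = 0`.**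
[cite: HulekLaface2019PicardNumbersAV, §6.2 Prop. 6.4 (explicit witness, this file)] -/
theorem eq_zero_of_map_C_eq_picardOnePolyMatrix_mul_mul {A₀ C₀ : Matrix (Fin n) (Fin n) ℤ}
    (h : A₀.map C = picardOnePolyMatrix n N * C₀.map C * picardOnePolyMatrix n N) {j k : Fin n}
    (hjk : j ≠ k) : C₀ = 0 := by
  ext l m
  have h1 := congrArg (fun M : Matrix (Fin n) (Fin n) ℤ[X] ↦
    (M j k).coeff (picardOneExponent n j l + picardOneExponent n m k)) h
  have hd0 : picardOneExponent n j l + picardOneExponent n m k ≠ 0 :=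
    (Nat.add_pos_left (Nat.pos_of_ne_zero (picardOneExponent_ne_zero n j l)) _).ne'
  simp only [coeff_picardOnePolyMatrix_mul_mul N C₀ hjk, Matrix.map_apply, coeff_C, if_neg hd0] at h1
  rw [Matrix.zero_apply, ← h1]

/-- **From the identity `ℬ𝒴 = 𝒴ᵗℬ` in `M_g(ℤ[X])` with `ℬ` constant: `ℬ` is a scalar matrix.**
[cite: HulekLaface2019PicardNumbersAV, §6.2 Prop. 6.4 (explicit witness, this file)] -/
theorem scalar_of_map_C_mul_picardOnePolyMatrix_eq {B₀ : Matrix (Fin n) (Fin n) ℤ}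
    (h : B₀.map C * picardOnePolyMatrix n N = picardOnePolyMatrix n N * (B₀.map C)ᵀ) :
    (∀ j l, j ≠ l → B₀ j l = 0) ∧ ∀ j k, B₀ j j = B₀ k k := by
  constructor
  · intro j l hjl
    have h1 := congrArg (fun M : Matrix (Fin n) (Fin n) ℤ[X] ↦
      (M j l).coeff (picardOneExponent n l l)) h
    simp only [coeff_map_mul_picardOnePolyMatrix, coeff_picardOnePolyMatrix_mul_map_transpose N B₀ hjl,
      if_neg (Ne.symm hjl)] at h1
    exact h1
  · intro j k
    by_cases hjk : j = k
    · rw [hjk]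
    have h1 := congrArg (fun M : Matrix (Fin n) (Fin n) ℤ[X] ↦
      (M j k).coeff (picardOneExponent n j k)) h
    simp only [coeff_map_mul_picardOnePolyMatrix, coeff_picardOnePolyMatrix_mul_map_transpose N B₀ hjk,
      if_true] at h1
    exact h1

end Poly

/-! ## §4 The real period matrix `Y = N·1 + (t^{e(a,b)})` and the transfer along `X ↦ t` -/

section Real

variable (n : ℕ) (N : ℤ) (t : ℝ)

/-- **`Y = picardOneMatrix g N t ∈ M_g(ℝ)`, `Y_{ab} = N δ_{ab} + t^{e(a,b)}`** — the imaginary part of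
the period matrix `(iY, 1_g)` of the witness (for `t` transcendental, `N > g`, `0 ≤ t ≤ 1`).
[cite: HulekLaface2019PicardNumbersAV, §6.2 Prop. 6.4 (explicit witness, this file)] -/
def picardOneMatrix : Matrix (Fin n) (Fin n) ℝ :=
  of fun a b ↦ (if a = b then (N : ℝ) else 0) + t ^ picardOneExponent n a b

/-- Entries of `Y`. [cite: HulekLaface2019PicardNumbersAV, §6.2 Prop. 6.4 (explicit witness, this file)] -/
theorem picardOneMatrix_apply (a b : Fin n) :
    picardOneMatrix n N t a b = (if a = b then (N : ℝ) else 0) + t ^ picardOneExponent n a b :=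
  rfl

/-- `Y = ᵗY`. [cite: HulekLaface2019PicardNumbersAV, §6.2 Prop. 6.4 (explicit witness, this file)] -/
theorem picardOneMatrix_transpose : (picardOneMatrix n N t)ᵀ = picardOneMatrix n N t := by
  ext a b
  simp only [transpose_apply, picardOneMatrix_apply, picardOneExponent_comm n b a, eq_comm]

/-- `Y` is the evaluation of `𝒴(X)` at `X = t`. [cite: HulekLaface2019PicardNumbersAV, §6.2 Prop. 6.4 (explicit witness, this file)] -/
theorem picardOneMatrix_eq_map : picardOneMatrix n N t = (picardOnePolyMatrix n N).map (aeval t) := by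
  ext a b
  simp only [picardOneMatrix_apply, Matrix.map_apply, picardOnePolyMatrix_apply, map_add, map_pow,
    aeval_X, aeval_C]
  split_ifs <;> simp

/-- Evaluation at `t` of a constant is the constant. [folklore] -/
private theorem aeval_comp_C :
    (⇑(aeval t : ℤ[X] →ₐ[ℤ] ℝ)) ∘ (⇑(C : ℤ →+* ℤ[X])) = (Int.cast : ℤ → ℝ) := by
  funext a
  rw [Function.comp_apply, aeval_C]
  simp

variable {n N t}

/-- **Transfer for `A = YCY`**: for `t` transcendental, integer matrices `A, C` with `A = YCY` over `ℝ`
(and `g ≥ 2`) vanish — evaluation `ℤ[X] → ℝ`, `X ↦ t` is injective, so `𝒜 = 𝒴𝒞𝒴` in `M_g(ℤ[X])`.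
[cite: HulekLaface2019PicardNumbersAV, §6.2 Prop. 6.4 (explicit witness, this file)] -/
theorem eq_zero_and_eq_zero_of_eq_picardOneMatrix_mul_mul (ht : Transcendental ℤ t)
    {A₀ C₀ : Matrix (Fin n) (Fin n) ℤ}
    (h : A₀.map (Int.cast : ℤ → ℝ) =
      picardOneMatrix n N t * C₀.map (Int.cast : ℤ → ℝ) * picardOneMatrix n N t)
    {j k : Fin n} (hjk : j ≠ k) : C₀ = 0 ∧ A₀ = 0 := by
  have hinj := Matrix.map_injective (m := Fin n) (n := Fin n) (transcendental_iff_injective.1 ht)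
  have key : A₀.map C = picardOnePolyMatrix n N * C₀.map C * picardOnePolyMatrix n N := by
    apply hinj
    change (A₀.map C).map (aeval t) =
      (picardOnePolyMatrix n N * C₀.map C * picardOnePolyMatrix n N).map (aeval t)
    rw [Matrix.map_mul, Matrix.map_mul, ← picardOneMatrix_eq_map, Matrix.map_map, Matrix.map_map,
      aeval_comp_C]
    exact h
  have hC : C₀ = 0 := eq_zero_of_map_C_eq_picardOnePolyMatrix_mul_mul N key hjk
  refine ⟨hC, ?_⟩
  rw [hC, Matrix.map_zero _ (Int.cast_zero (R := ℝ)), Matrix.mul_zero, Matrix.zero_mul] at h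
  exact Matrix.map_injective (Int.cast_injective (α := ℝ))
    (h.trans (Matrix.map_zero _ Int.cast_zero).symm)

/-- **Transfer for `BY = YᵗB`**: for `t` transcendental, an integer matrix `B` with `BY = YᵗB` over `ℝ`
is scalar. [cite: HulekLaface2019PicardNumbersAV, §6.2 Prop. 6.4 (explicit witness, this file)] -/
theorem scalar_of_mul_picardOneMatrix_eq (ht : Transcendental ℤ t) {B₀ : Matrix (Fin n) (Fin n) ℤ}
    (h : B₀.map (Int.cast : ℤ → ℝ) * picardOneMatrix n N t =
      picardOneMatrix n N t * (B₀.map (Int.cast : ℤ → ℝ))ᵀ) :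
    (∀ j l, j ≠ l → B₀ j l = 0) ∧ ∀ j k, B₀ j j = B₀ k k := by
  have hinj := Matrix.map_injective (m := Fin n) (n := Fin n) (transcendental_iff_injective.1 ht)
  have key : B₀.map C * picardOnePolyMatrix n N = picardOnePolyMatrix n N * (B₀.map C)ᵀ := by
    apply hinj
    change (B₀.map C * picardOnePolyMatrix n N).map (aeval t) =
      (picardOnePolyMatrix n N * (B₀.map C)ᵀ).map (aeval t)
    rw [Matrix.map_mul, Matrix.map_mul, ← picardOneMatrix_eq_map, Matrix.transpose_map,
      Matrix.map_map, aeval_comp_C, ← Matrix.transpose_map]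
    exact h
  exact scalar_of_map_C_mul_picardOnePolyMatrix_eq N key

end Real

/-! ## §5 Exercise 1.3.4 (9) at a purely imaginary period matrix: `A = YCY`, `BY = YᵗB` -/

section IMatrix

variable {κ : Type*} [Fintype κ] [DecidableEq κ]

omit [Fintype κ] [DecidableEq κ] in
/-- Real and imaginary parts of a matrix equation `M + iN = 0` with `M, N` real. [folklore] -/
private theorem map_ofReal_add_I_smul_map_ofReal_eq_zero_iff {M N : Matrix κ κ ℝ} :
    M.map ofReal + I • N.map ofReal = 0 ↔ M = 0 ∧ N = 0 := by
  constructor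
  · intro h
    have h' : ∀ a b, (M a b : ℂ) + I * (N a b : ℂ) = 0 := fun a b ↦ by
      have := congrFun (congrFun h a) b
      simpa using this
    constructor
    · ext a b
      have := congrArg Complex.re (h' a b)
      simpa using this
    · ext a b
      have := congrArg Complex.im (h' a b)
      simpa using this
  · rintro ⟨rfl, rfl⟩
    ext a b
    simp

omit [Fintype κ] [DecidableEq κ] in
/-- `Im (iY) = Y` for a real matrix `Y` (any size; the tree's `det_map_im_iMatrix` is `2 × 2`).
[cite: Lange2023AbelianVarietiesComplex, §5.1.5 Exercise (3) (the period matrix `(iY, 1)`)] -/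
theorem map_im_I_smul_map_ofReal (Y : Matrix κ κ ℝ) : (I • Y.map ofReal).map Complex.im = Y := by
  ext a b
  simp

/-- `det (Im (iY)) = det Y`: `(iY, 1_g)` is a period matrix iff `det Y ≠ 0` (Exercise 1.1.6 (1), the
hypothesis of `periodIsoOfNormalForm`). [cite: Lange2023AbelianVarietiesComplex, §5.1.5 Exercise (3) with §1.1.6 Exercise (1)] -/
theorem det_map_im_I_smul_map_ofReal (Y : Matrix κ κ ℝ) :
    ((I • Y.map ofReal).map Complex.im).det = Y.det := by
  rw [map_im_I_smul_map_ofReal]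

/-- **Condition (ii) of Exercise 1.3.4 (9) at `Z = iY`, `Y = ᵗY` real**: for an antisymmetric real
`G = (A B; -ᵗB C)`, `A - BZ + ᵗZᵗB + ᵗZCZ = (A - YCY) + i(YᵗB - BY)`.
[cite: Lange2023AbelianVarietiesComplex, §1.3 Exercise 1.3.4 (9) with §5.1.5 Exercise (3)(a)] -/
theorem nsRelation_I_smul_of_transpose_eq_neg {Y : Matrix κ κ ℝ} (hY : Yᵀ = Y)
    {G : Matrix (κ ⊕ κ) (κ ⊕ κ) ℝ} (hG : Gᵀ = -G) :
    nsRelation (I • Y.map ofReal) (G.map ofReal) =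
      (G.toBlocks₁₁ - Y * G.toBlocks₂₂ * Y).map ofReal +
        I • (Y * (G.toBlocks₁₂)ᵀ - G.toBlocks₁₂ * Y).map ofReal := by
  have hG' : (G.map ofReal)ᵀ = -(G.map ofReal) := by
    rw [← transpose_map, hG]
    ext a b
    simp
  rw [nsRelation_eq_of_transpose_eq_neg _ hG']
  -- every `M.map ofReal` is `φ M` for the ring homomorphism `φ = ofRealHom.mapMatrix`
  have h11 : (G.map ofReal).toBlocks₁₁ = Complex.ofRealHom.mapMatrix G.toBlocks₁₁ := rfl
  have h12 : (G.map ofReal).toBlocks₁₂ = Complex.ofRealHom.mapMatrix G.toBlocks₁₂ := rfl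
  have h22 : (G.map ofReal).toBlocks₂₂ = Complex.ofRealHom.mapMatrix G.toBlocks₂₂ := rfl
  have hY' : Y.map ofReal = Complex.ofRealHom.mapMatrix Y := rfl
  have hYt : (Complex.ofRealHom.mapMatrix Y)ᵀ = Complex.ofRealHom.mapMatrix Y := by
    rw [RingHom.mapMatrix_apply, ← transpose_map, hY]
  have hBt : (Complex.ofRealHom.mapMatrix G.toBlocks₁₂)ᵀ =
      Complex.ofRealHom.mapMatrix (G.toBlocks₁₂)ᵀ := by
    rw [RingHom.mapMatrix_apply, RingHom.mapMatrix_apply, transpose_map]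
  rw [h11, h12, h22, hY',
    show (G.toBlocks₁₁ - Y * G.toBlocks₂₂ * Y).map ofReal =
      Complex.ofRealHom.mapMatrix (G.toBlocks₁₁ - Y * G.toBlocks₂₂ * Y) from rfl,
    show (Y * (G.toBlocks₁₂)ᵀ - G.toBlocks₁₂ * Y).map ofReal =
      Complex.ofRealHom.mapMatrix (Y * (G.toBlocks₁₂)ᵀ - G.toBlocks₁₂ * Y) from rfl,
    transpose_smul, hYt, hBt, map_sub, map_sub, map_mul, map_mul, map_mul, map_mul]
  simp only [Matrix.mul_smul, Matrix.smul_mul, smul_smul, Complex.I_mul_I, neg_smul, one_smul,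
    smul_sub]
  abel

/-- **Exercise 1.3.4 (9) for `X = ℂ^g/(iYℤ^g ⊕ ℤ^g)`, `Y = ᵗY` real, every `g`** (the route printed for
`g = 2` in Exercise 5.1.5 (3)(a), "Use Exercise 1.3.4 (9)"): an integer matrix `G = (A B; -ᵗB C)` lies in
the group `nsMatrices (iY) ≅ NS(X)` of the exercise iff it is antisymmetric with `A = YCY` and
`BY = YᵗB` — the real and imaginary parts of condition (ii) at `Z = iY`.
[cite: Lange2023AbelianVarietiesComplex, §1.3 Exercise 1.3.4 (9) with §5.1.5 Exercise (3)(a)] -/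
theorem mem_nsMatrices_I_smul_iff {Y : Matrix κ κ ℝ} (hY : Yᵀ = Y) {G₀ : Matrix (κ ⊕ κ) (κ ⊕ κ) ℤ} :
    G₀ ∈ nsMatrices (I • Y.map ofReal) ↔
      G₀ᵀ = -G₀ ∧
        (G₀.map (Int.cast : ℤ → ℝ)).toBlocks₁₁ =
            Y * (G₀.map (Int.cast : ℤ → ℝ)).toBlocks₂₂ * Y ∧
          (G₀.map (Int.cast : ℤ → ℝ)).toBlocks₁₂ * Y =
            Y * ((G₀.map (Int.cast : ℤ → ℝ)).toBlocks₁₂)ᵀ := by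
  rw [mem_nsMatrices_iff]
  refine and_congr_right fun hG ↦ ?_
  have hcast : G₀.map (Int.cast : ℤ → ℂ) = (G₀.map (Int.cast : ℤ → ℝ)).map ofReal := by
    rw [Matrix.map_map]
    exact Matrix.ext fun a b ↦ (Complex.ofReal_intCast (G₀ a b)).symm
  have hGr : (G₀.map (Int.cast : ℤ → ℝ))ᵀ = -G₀.map (Int.cast : ℤ → ℝ) := by
    rw [← transpose_map, hG, Matrix.map_neg _ Int.cast_neg]
  rw [hcast, nsRelation_I_smul_of_transpose_eq_neg hY hGr,
    map_ofReal_add_I_smul_map_ofReal_eq_zero_iff, sub_eq_zero, sub_eq_zero]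
  exact and_congr Iff.rfl eq_comm

end IMatrix

/-! ## §6 `NS(ℂ^g/(iYℤ^g ⊕ ℤ^g)) = ℤ·E₀` for `Y = N·1 + (t^{e(a,b)})`, `t` transcendental -/

section Structure

variable {n : ℕ} {N : ℤ} {t : ℝ}

/-- The diagonal of an antisymmetric integer matrix vanishes. [folklore] -/
private theorem apply_self_eq_zero_of_transpose_eq_neg {m : Type*} {G : Matrix m m ℤ} (hG : Gᵀ = -G)
    (i : m) : G i i = 0 := by
  have h := congrFun (congrFun hG i) i
  simp only [transpose_apply, Matrix.neg_apply] at h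
  omega

/-- For an antisymmetric `G` the lower-left block is `-ᵗB`. [folklore] -/
private theorem toBlocks₂₁_eq_neg_transpose {m : Type*} {G : Matrix (m ⊕ m) (m ⊕ m) ℤ}
    (hG : Gᵀ = -G) : G.toBlocks₂₁ = -(G.toBlocks₁₂)ᵀ := by
  ext i j
  have h := congrFun (congrFun hG (Sum.inr i)) (Sum.inl j)
  simp only [transpose_apply, Matrix.neg_apply] at h
  simp only [toBlocks₂₁, toBlocks₁₂, of_apply, Matrix.neg_apply, transpose_apply]
  rw [h, neg_neg]

/-- `(b·1_g) ∈ M_g(ℤ)` read in `ℝ` is `b·1_g`. [folklore] -/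
private theorem map_intCast_smul_one (b : ℤ) :
    (b • (1 : Matrix (Fin n) (Fin n) ℤ)).map (Int.cast : ℤ → ℝ) = (b : ℝ) • (1 : Matrix (Fin n) (Fin n) ℝ) := by
  ext i j
  simp only [Matrix.map_apply, Matrix.smul_apply, Matrix.one_apply, smul_eq_mul, mul_ite, mul_one,
    mul_zero]
  split_ifs <;> simp

/-- **`NS = ℤ·E₀` for the witness**: for `t ∈ ℝ` transcendental and `N ∈ ℤ`, an integer matrix lies in
`nsMatrices (iY)`, `Y = N·1 + (t^{e(a,b)})` — i.e. (Exercise 1.3.4 (9)) represents a class of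
`NS(ℂ^g/(iYℤ^g ⊕ ℤ^g))` — iff it is an integer multiple of `E₀ = (0 1_g; -1_g 0)` (the polarization
`H = Y⁻¹` when `Y ≻ 0`).  By §5 membership means `A = YCY`, `BY = YᵗB`; by §4 `C = 0 = A` and `B = b·1`
(for `g = 1`: `A = C = 0` as `1 × 1` alternating matrices). [cite: HulekLaface2019PicardNumbersAV, §6.2 Prop. 6.4 (explicit witness, this file)] [cite: Lange2023AbelianVarietiesComplex, §1.3 Exercise 1.3.4 (9)] -/
theorem mem_nsMatrices_picardOneMatrix_iff (ht : Transcendental ℤ t) (N : ℤ)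
    {G₀ : Matrix (Fin n ⊕ Fin n) (Fin n ⊕ Fin n) ℤ} :
    G₀ ∈ nsMatrices (I • (picardOneMatrix n N t).map ofReal) ↔
      ∃ b : ℤ, G₀ = b • Matrix.fromBlocks 0 1 (-1) 0 := by
  rw [mem_nsMatrices_I_smul_iff (picardOneMatrix_transpose n N t)]
  constructor
  · rintro ⟨hG, hA, hB⟩
    have hA' : (G₀.toBlocks₁₁).map (Int.cast : ℤ → ℝ) =
        picardOneMatrix n N t * (G₀.toBlocks₂₂).map (Int.cast : ℤ → ℝ) * picardOneMatrix n N t := hA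
    have hB' : (G₀.toBlocks₁₂).map (Int.cast : ℤ → ℝ) * picardOneMatrix n N t =
        picardOneMatrix n N t * ((G₀.toBlocks₁₂).map (Int.cast : ℤ → ℝ))ᵀ := hB
    -- `C = 0` and `A = 0`
    have hCA : G₀.toBlocks₂₂ = 0 ∧ G₀.toBlocks₁₁ = 0 := by
      by_cases h2 : ∃ j k : Fin n, j ≠ k
      · obtain ⟨j, k, hjk⟩ := h2
        exact eq_zero_and_eq_zero_of_eq_picardOneMatrix_mul_mul ht hA' hjk
      · push Not at h2
        refine ⟨?_, ?_⟩
        · ext l m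
          rw [h2 l m]
          exact apply_self_eq_zero_of_transpose_eq_neg hG (Sum.inr m)
        · ext l m
          rw [h2 l m]
          exact apply_self_eq_zero_of_transpose_eq_neg hG (Sum.inl m)
    obtain ⟨hC, hA0⟩ := hCA
    -- `B = b·1`
    obtain ⟨hoff, hdiag⟩ := scalar_of_mul_picardOneMatrix_eq ht hB'
    obtain ⟨b, hb⟩ : ∃ b : ℤ, ∀ j, G₀.toBlocks₁₂ j j = b := by
      rcases isEmpty_or_nonempty (Fin n) with h | ⟨⟨j₀⟩⟩
      · exact ⟨0, fun j ↦ isEmptyElim j⟩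
      · exact ⟨G₀.toBlocks₁₂ j₀ j₀, fun j ↦ hdiag j j₀⟩
    have hB1 : G₀.toBlocks₁₂ = b • (1 : Matrix (Fin n) (Fin n) ℤ) := by
      ext j l
      by_cases hjl : j = l
      · subst hjl; simp [hb j]
      · simp [Matrix.one_apply_ne hjl, hoff j l hjl]
    refine ⟨b, ?_⟩
    rw [← fromBlocks_toBlocks G₀, toBlocks₂₁_eq_neg_transpose hG, hA0, hB1, hC, fromBlocks_smul,
      smul_zero, transpose_smul, transpose_one, smul_neg]
  · rintro ⟨b, rfl⟩
    have hJ : b • (Matrix.fromBlocks 0 1 (-1) 0 : Matrix (Fin n ⊕ Fin n) (Fin n ⊕ Fin n) ℤ) =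
        Matrix.fromBlocks 0 (b • 1) (-(b • 1)) 0 := by
      rw [fromBlocks_smul, smul_zero, smul_neg]
    refine ⟨?_, ?_, ?_⟩
    · rw [hJ, fromBlocks_transpose, fromBlocks_neg]
      simp
    · rw [hJ, fromBlocks_map, toBlocks_fromBlocks₁₁, toBlocks_fromBlocks₂₂,
        Matrix.map_zero _ (Int.cast_zero (R := ℝ)), Matrix.mul_zero, Matrix.zero_mul]
    · rw [hJ, fromBlocks_map, toBlocks_fromBlocks₁₂, map_intCast_smul_one, Matrix.smul_mul,
        transpose_smul, transpose_one, Matrix.mul_smul, Matrix.one_mul, Matrix.mul_one]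

/-- **`rank NS = 1` for the witness** (`g ≥ 1`): `nsMatrices (iY) = ℤ·E₀ ≅ ℤ`.
[cite: HulekLaface2019PicardNumbersAV, §6.2 Prop. 6.4 (explicit witness, this file)] -/
theorem finrank_nsMatrices_picardOneMatrix [NeZero n] (ht : Transcendental ℤ t) (N : ℤ) :
    finrank ℤ (nsMatrices (I • (picardOneMatrix n N t).map ofReal)) = 1 := by
  set Z : Matrix (Fin n) (Fin n) ℂ := I • (picardOneMatrix n N t).map ofReal with hZ
  have hmem : ∀ b : ℤ,
      b • (Matrix.fromBlocks 0 1 (-1) 0 : Matrix (Fin n ⊕ Fin n) (Fin n ⊕ Fin n) ℤ) ∈ nsMatrices Z :=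
    fun b ↦ (mem_nsMatrices_picardOneMatrix_iff ht N).2 ⟨b, rfl⟩
  let f : ℤ →+ nsMatrices Z :=
    { toFun := fun b ↦ ⟨b • Matrix.fromBlocks 0 1 (-1) 0, hmem b⟩
      map_zero' := Subtype.ext (zero_smul ℤ _)
      map_add' := fun a b ↦ Subtype.ext (add_smul a b _) }
  have hf : Function.Bijective f := by
    constructor
    · intro a b hab
      have h := congrArg (fun G : nsMatrices Z ↦
        (G : Matrix (Fin n ⊕ Fin n) (Fin n ⊕ Fin n) ℤ) (Sum.inl (0 : Fin n)) (Sum.inr (0 : Fin n))) hab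
      change (a • (Matrix.fromBlocks 0 1 (-1) 0 : Matrix (Fin n ⊕ Fin n) (Fin n ⊕ Fin n) ℤ))
          (Sum.inl 0) (Sum.inr 0) =
        (b • (Matrix.fromBlocks 0 1 (-1) 0 : Matrix (Fin n ⊕ Fin n) (Fin n ⊕ Fin n) ℤ))
          (Sum.inl 0) (Sum.inr 0) at h
      simpa only [Matrix.smul_apply, fromBlocks_apply₁₂, Matrix.one_apply_eq, smul_eq_mul,
        mul_one] using h
    · intro G
      obtain ⟨b, hb⟩ := (mem_nsMatrices_picardOneMatrix_iff ht N).1 G.2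
      exact ⟨b, Subtype.ext hb.symm⟩
  rw [← ((AddEquiv.ofBijective f hf).toIntLinearEquiv).finrank_eq, Module.finrank_self]

/-- **The complex torus `ℂ^g/(iYℤ^g ⊕ ℤ^g)`, `Y = N·1 + (t^{e(a,b)})` with `t` transcendental and
`det Y ≠ 0`, has Picard number `ρ = rk NS = 1`** (`g ≥ 1`; through the tree's
`nsMatricesEquivOfNormalForm : NS(X) ≃+ nsMatrices Z`). [cite: HulekLaface2019PicardNumbersAV, §6.2 Prop. 6.4 (explicit witness, this file)] [cite: Lange2023AbelianVarietiesComplex, §1.3 Exercises 1.3.4 (9), (10)] -/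
theorem finrank_neronSeveriGroup_periodIsoOfNormalForm_picardOneMatrix [NeZero n]
    (ht : Transcendental ℤ t) (N : ℤ)
    (hZ : ((I • (picardOneMatrix n N t).map ofReal).map Complex.im).det ≠ 0) :
    finrank ℤ (neronSeveriGroup (periodIsoOfNormalForm (I • (picardOneMatrix n N t).map ofReal) hZ)) = 1 := by
  rw [(nsMatricesEquivOfNormalForm _ hZ).toIntLinearEquiv.finrank_eq,
    finrank_nsMatrices_picardOneMatrix ht N]

/-- **`Y = N·1 + (t^{e(a,b)})` is positive definite for `0 ≤ t ≤ 1` and `N > g`**: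
`ᵗxYx = N|x|² + Σ_{a,b} x_a t^{e(a,b)} x_b ≥ N|x|² − Σ_{a,b} |x_a||x_b| ≥ (N − g)|x|²`.
[cite: HulekLaface2019PicardNumbersAV, §6.2 Prop. 6.4 (explicit witness, this file)] -/
theorem posDef_picardOneMatrix (ht0 : 0 ≤ t) (ht1 : t ≤ 1) (hN : (n : ℤ) < N) :
    (picardOneMatrix n N t).PosDef := by
  refine Matrix.posDef_iff_dotProduct_mulVec.2 ⟨?_, fun x hx ↦ ?_⟩
  · exact Matrix.IsHermitian.ext fun i j ↦ by
      rw [star_trivial, ← transpose_apply (picardOneMatrix n N t) i j, picardOneMatrix_transpose]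
  · -- the quadratic form
    have hq : star x ⬝ᵥ (picardOneMatrix n N t *ᵥ x) =
        (N : ℝ) * ∑ i, x i ^ 2 + ∑ i, ∑ j, x i * t ^ picardOneExponent n i j * x j := by
      have h1 : ∀ i, (picardOneMatrix n N t *ᵥ x) i =
          (N : ℝ) * x i + ∑ j, t ^ picardOneExponent n i j * x j := by
        intro i
        simp only [mulVec, dotProduct, picardOneMatrix_apply, add_mul, Finset.sum_add_distrib, ite_mul,
          zero_mul, Finset.sum_ite_eq, Finset.mem_univ, if_true]
      simp only [star_trivial, dotProduct, h1, mul_add, Finset.sum_add_distrib, Finset.mul_sum]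
      congr 1
      · exact Finset.sum_congr rfl fun i _ ↦ by ring
      · exact Finset.sum_congr rfl fun i _ ↦ Finset.sum_congr rfl fun j _ ↦ by ring
    have hsq : 0 < ∑ i, x i ^ 2 := by
      obtain ⟨i, hi⟩ : ∃ i, x i ≠ 0 := by
        by_contra h
        push Not at h
        exact hx (funext h)
      exact lt_of_lt_of_le (by positivity : 0 < x i ^ 2)
        (Finset.single_le_sum (fun j _ ↦ sq_nonneg (x j)) (Finset.mem_univ i))
    have hS : -((n : ℝ) * ∑ i, x i ^ 2) ≤ ∑ i, ∑ j, x i * t ^ picardOneExponent n i j * x j := by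
      have hterm : ∀ i j, -(x i ^ 2 + x j ^ 2) ≤ 2 * (x i * t ^ picardOneExponent n i j * x j) := by
        intro i j
        have h0 : 0 ≤ t ^ picardOneExponent n i j := pow_nonneg ht0 _
        have h1 : t ^ picardOneExponent n i j ≤ 1 := pow_le_one₀ ht0 ht1
        nlinarith [mul_nonneg h0 (sq_nonneg (x i + x j)),
          mul_nonneg (sub_nonneg.2 h1) (add_nonneg (sq_nonneg (x i)) (sq_nonneg (x j)))]
      have hdouble : ∑ i : Fin n, ∑ j : Fin n, (x i ^ 2 + x j ^ 2) = 2 * ((n : ℝ) * ∑ i, x i ^ 2) := by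
        simp only [Finset.sum_add_distrib, Finset.sum_const, Finset.card_univ, Fintype.card_fin,
          nsmul_eq_mul]
        rw [← Finset.mul_sum]
        ring
      have hle : ∑ i : Fin n, ∑ j : Fin n, -(x i ^ 2 + x j ^ 2) ≤
          ∑ i : Fin n, ∑ j : Fin n, 2 * (x i * t ^ picardOneExponent n i j * x j) :=
        Finset.sum_le_sum fun i _ ↦ Finset.sum_le_sum fun j _ ↦ hterm i j
      simp only [Finset.sum_neg_distrib, ← Finset.mul_sum, hdouble] at hle
      linarith
    rw [hq]
    have hNn : (n : ℝ) + 1 ≤ (N : ℝ) := by exact_mod_cast hN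
    nlinarith [mul_nonneg (sub_nonneg.2 hNn) hsq.le]

end Structure

/-! ## §7 The explicit abelian variety `X_g^L = ℂ^g/(iYℤ^g ⊕ ℤ^g)`, `Y = (g+1)·1 + (ℓ^{e(a,b)})`,
`ℓ = Σ_k 3^{-k!}` -/

section Liouville

/-- `ℓ = liouvilleNumber 3 = Σ_{k ≥ 0} 3^{-k!} > 0` (its first term is `1/3`). [folklore] -/
private theorem liouvilleNumber_three_pos : 0 < liouvilleNumber 3 := by
  have h := LiouvilleNumber.partialSum_add_remainder (m := 3) (by norm_num) 0
  have hp : LiouvilleNumber.partialSum 3 0 = 1 / 3 := by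
    simp [LiouvilleNumber.partialSum]
  have hr := LiouvilleNumber.remainder_pos (m := 3) (by norm_num) 0
  linarith

/-- `ℓ = liouvilleNumber 3 < 1` (`ℓ = 1/3 + r`, `r < (1 − 1/3)⁻¹·3^{-1} = 1/2`). [folklore] -/
private theorem liouvilleNumber_three_lt_one : liouvilleNumber 3 < 1 := by
  have h := LiouvilleNumber.partialSum_add_remainder (m := 3) (by norm_num) 0
  have hp : LiouvilleNumber.partialSum 3 0 = 1 / 3 := by
    simp [LiouvilleNumber.partialSum]
  have hr := LiouvilleNumber.remainder_lt' 0 (m := 3) (by norm_num)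
  norm_num [Nat.factorial] at hr
  linarith

/-- `ℓ` is transcendental (Liouville's theorem, Mathlib's `transcendental_liouvilleNumber`). [folklore] -/
private theorem transcendental_liouvilleNumber_three : Transcendental ℤ (liouvilleNumber 3) := by
  simpa using transcendental_liouvilleNumber (m := 3) (by norm_num)

/-- **The period matrix of the witness**: `Y_g^L = (g+1)·1_g + (ℓ^{e(a,b)})_{a,b} ∈ M_g(ℝ)`,
`ℓ = Σ_k 3^{-k!}` Liouville's constant to base `3`. [cite: HulekLaface2019PicardNumbersAV, §6.2 Prop. 6.4 (explicit witness, this file)] -/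
def liouvillePeriodMatrix (n : ℕ) : Matrix (Fin n) (Fin n) ℝ :=
  picardOneMatrix n (n + 1) (liouvilleNumber 3)

/-- `Y_g^L` is positive definite. [cite: HulekLaface2019PicardNumbersAV, §6.2 Prop. 6.4 (explicit witness, this file)] -/
theorem posDef_liouvillePeriodMatrix (n : ℕ) : (liouvillePeriodMatrix n).PosDef :=
  posDef_picardOneMatrix liouvilleNumber_three_pos.le liouvilleNumber_three_lt_one.le (by omega)

/-- `Y_g^L = ᵗY_g^L`. [cite: HulekLaface2019PicardNumbersAV, §6.2 Prop. 6.4 (explicit witness, this file)] -/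
theorem liouvillePeriodMatrix_transpose (n : ℕ) : (liouvillePeriodMatrix n)ᵀ = liouvillePeriodMatrix n :=
  picardOneMatrix_transpose n _ _

/-- `det (Im (iY_g^L)) = det Y_g^L ≠ 0`: `(iY_g^L, 1_g)` is a period matrix.
[cite: HulekLaface2019PicardNumbersAV, §6.2 Prop. 6.4 (explicit witness, this file)] [cite: Lange2023AbelianVarietiesComplex, §1.1.6 Exercise (1)] -/
theorem det_map_im_liouvillePeriodMatrix_ne_zero (n : ℕ) :
    ((I • (liouvillePeriodMatrix n).map ofReal).map Complex.im).det ≠ 0 := by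
  rw [det_map_im_I_smul_map_ofReal]
  exact (posDef_liouvillePeriodMatrix n).det_pos.ne'

/-- **The witness `X_g^L = ℂ^g/(iY_g^Lℤ^g ⊕ ℤ^g)`** as a period isomorphism `ℝ^{2g} ≃ ℂ^g` (the tree's
normal form `periodIsoOfNormalForm (iY_g^L)`, Exercise 1.1.6 (1)). [cite: HulekLaface2019PicardNumbersAV, §6.2 Prop. 6.4 (explicit witness, this file)] -/
def liouvillePeriod (n : ℕ) : (Fin n ⊕ Fin n → ℝ) ≃L[ℝ] (Fin n → ℂ) :=
  periodIsoOfNormalForm (I • (liouvillePeriodMatrix n).map ofReal) (det_map_im_liouvillePeriodMatrix_ne_zero n)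

/-- **`X_g^L` is an abelian variety** (`iY_g^L` is symmetric with positive definite imaginary part:
Riemann's relations, Prop. 3.1.1, through the tree's `isAbelianVariety_periodIsoOfNormalForm_of_posDef`).
[cite: HulekLaface2019PicardNumbersAV, §6.2 Prop. 6.4 (explicit witness, this file)] [cite: Lange2023AbelianVarietiesComplex, §3.1 Prop. 3.1.1] -/
theorem isAbelianVariety_liouvillePeriod (n : ℕ) : IsAbelianVariety (liouvillePeriod n) := by
  refine isAbelianVariety_periodIsoOfNormalForm_of_posDef _ _ (fun i j ↦ ?_) ?_
  · have h := congrFun (congrFun (liouvillePeriodMatrix_transpose n) j) i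
    rw [transpose_apply] at h
    simp only [Matrix.smul_apply, Matrix.map_apply, h]
  · have h : (Matrix.of fun i j ↦ ((I • (liouvillePeriodMatrix n).map ofReal) i j).im) =
        liouvillePeriodMatrix n := by
      ext i j
      simp
    rw [h]
    exact posDef_liouvillePeriodMatrix n

/-- **`ρ(X_g^L) = 1`: the witness has Picard number one** (`g ≥ 1`).
[cite: HulekLaface2019PicardNumbersAV, §6.2 Prop. 6.4 (explicit witness, this file) and §1 ("a very general abelian threefold has Picard number `ρ = 1`")] -/
theorem finrank_neronSeveriGroup_liouvillePeriod (n : ℕ) [NeZero n] :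
    finrank ℤ (neronSeveriGroup (liouvillePeriod n)) = 1 :=
  finrank_neronSeveriGroup_periodIsoOfNormalForm_picardOneMatrix transcendental_liouvilleNumber_three _ _

/-- **`NS(X_g^L) = ℤ·H`**: the integer matrices of the classes of `NS(X_g^L)` (Exercise 1.3.4 (9)) are
exactly the multiples of `E₀ = (0 1; -1 0)`. [cite: HulekLaface2019PicardNumbersAV, §6.2 Prop. 6.4 (explicit witness, this file)] [cite: Lange2023AbelianVarietiesComplex, §1.3 Exercise 1.3.4 (9)] -/
theorem mem_nsMatrices_liouvillePeriodMatrix_iff {n : ℕ} {G₀ : Matrix (Fin n ⊕ Fin n) (Fin n ⊕ Fin n) ℤ} :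
    G₀ ∈ nsMatrices (I • (liouvillePeriodMatrix n).map ofReal) ↔
      ∃ b : ℤ, G₀ = b • Matrix.fromBlocks 0 1 (-1) 0 :=
  mem_nsMatrices_picardOneMatrix_iff transcendental_liouvilleNumber_three _

end Liouville

/-! ## §8 `1 ∈ R_g`; Prop. 6.4 `{1, …, 2g} ⊆ R_g`; `R_3 = {1, …, 6, 9}`; the boxes made explicit -/

section PicardNumbers

/-- **`1 ∈ R_g` for every `g ≥ 1`: there is an abelian variety of dimension `g` with Picard number one**
(the witness `X_g^L`). [cite: HulekLaface2019PicardNumbersAV, §6.2 Prop. 6.4 ("`{1, …, 2g} ⊂ R_g`") and §1 ("a very general abelian threefold has Picard number `ρ = 1`")] -/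
theorem one_mem_picardNumbers {g : ℕ} (hg : 1 ≤ g) : 1 ∈ picardNumbers g := by
  haveI : NeZero g := ⟨by omega⟩
  have h := (isAbelianVariety_liouvillePeriod g).mem_picardNumbers
  rwa [finrank_neronSeveriGroup_liouvillePeriod, Module.finrank_fin_fun] at h

/-- **`t² + 1 ∈ R_{t+k}` for every `k ≥ 1`** (`E^t × X_k^L` with `E` a CM elliptic curve with
`Hom(E, X_k^L) = 0`): the first member `(g−k)² + 1` of every box `R_{g,k} = (g−k)² + R_k` of Thm. 7.4.
[cite: HulekLaface2019PicardNumbersAV, §7.2 Thm. 7.4 (`R_{g,k} = (g−k)² + R_k`) with §6.2 Prop. 6.4] -/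
theorem sq_add_one_mem_picardNumbers_add {k : ℕ} (hk : 1 ≤ k) (t : ℕ) :
    t ^ 2 + 1 ∈ picardNumbers (t + k) :=
  sq_add_mem_picardNumbers_of_mem (one_mem_picardNumbers hk) t

/-- **`k + 1 ∈ R_{k+m}` for `m ≥ 1`** (`X_m^L × E_1 × ⋯ × E_k` with pairwise non-isogenous CM elliptic
curves `E_i`, `Hom(E_i, ·) = 0`: Picard number `1 + k`). [cite: HulekLaface2019PicardNumbersAV, §6.2 Prop. 6.4 (proof: "the result easily follows by induction on `g`", additivity Prop. 6.2 / Cor. 2.3)] -/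
theorem succ_mem_picardNumbers_add (k : ℕ) {m : ℕ} (hm : 1 ≤ m) : k + 1 ∈ picardNumbers (k + m) := by
  induction k with
  | zero => simpa using one_mem_picardNumbers hm
  | succ k ih =>
    have h := sq_add_mem_picardNumbers_of_mem ih 1
    rw [one_pow, show 1 + (k + 1) = k + 1 + 1 by ring, show 1 + (k + m) = k + 1 + m by ring] at h
    exact h

/-- **`{1, …, g} ⊆ R_g`** (the lower half of Prop. 6.4, the part needing abelian varieties of Picard
number one). [cite: HulekLaface2019PicardNumbersAV, §6.2 Prop. 6.4] -/
theorem Icc_one_subset_picardNumbers (g : ℕ) : Set.Icc 1 g ⊆ picardNumbers g := by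
  intro k hk
  obtain ⟨h1, h2⟩ := Set.mem_Icc.1 hk
  obtain ⟨j, rfl⟩ : ∃ j, k = j + 1 := ⟨k - 1, by omega⟩
  have h := succ_mem_picardNumbers_add j (m := g - j) (by omega)
  rwa [show j + (g - j) = g by omega] at h

/-- **Hulek–Laface 2019, Proposition 6.4, AS PRINTED: "Given `g ≥ 2`, consider the set `R_g` of Picard
numbers of abelian varieties of dimension `g`. Then, `{1, …, 2g} ⊂ R_g`."** — `{1, …, g}` by the
witnesses `X_m^L` times CM elliptic curves (`Icc_one_subset_picardNumbers`), `{g, …, 2g}` by products of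
elliptic curves (Remark 6.5, the tree's `exists_abelianVariety_finrank_eq_and_finrank_neronSeveriGroup_eq`).
[cite: HulekLaface2019PicardNumbersAV, §6.2 Prop. 6.4] -/
theorem Icc_one_two_mul_subset_picardNumbers {g : ℕ} (hg : 2 ≤ g) :
    Set.Icc 1 (2 * g) ⊆ picardNumbers g := by
  intro k hk
  obtain ⟨h1, h2⟩ := Set.mem_Icc.1 hk
  by_cases hkg : k ≤ g
  · exact Icc_one_subset_picardNumbers g (Set.mem_Icc.2 ⟨h1, hkg⟩)
  · obtain ⟨r, τ, hτ, m, hA, hdim, hρ⟩ :=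
      exists_abelianVariety_finrank_eq_and_finrank_neronSeveriGroup_eq hg (by omega) h2
    have h := hA.mem_picardNumbers
    rwa [hdim, hρ] at h

/-- **`R_3 = {1, …, 6, 9}` AS PRINTED** ("it is not hard to show that `R_3 = {1, …, 6, 9}`: indeed, a
very general abelian threefold has Picard number `ρ = 1` …"; the tree had `{2, …, 6, 9} ⊆ R_3 ⊆
{1, …, 6, 9}`, the witness `X_3^L` supplies `1`). [cite: HulekLaface2019PicardNumbersAV, §1 ("`R_3 = {1, …, 6, 9}`")] -/
theorem picardNumbers_three : picardNumbers 3 = Set.Icc 1 6 ∪ {9} := by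
  refine Set.Subset.antisymm picardNumbers_three_subset fun y hy ↦ ?_
  rcases hy with hy | hy
  · exact Icc_one_two_mul_subset_picardNumbers (g := 3) (by norm_num) (by simpa using hy)
  · rw [Set.mem_singleton_iff] at hy
    subst hy
    exact subset_picardNumbers_three (by simp)

/-- **The box `R_{g,3}` as an explicit set, `g ≥ 12`: `R_g ∩ ((g−3)², (g−3)² + 9] = (g−3)² + {1, …, 6, 9}`.**
[cite: HulekLaface2019PicardNumbersAV, §7.2 Thm. 7.4 (the box `R_{g,3} = (g−3)² + R_3`) with §1 (`R_3 = {1, …, 6, 9}`)] -/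
theorem picardNumbers_inter_Ioc_thirdBox_eq {g : ℕ} (hg : 12 ≤ g) :
    picardNumbers g ∩ Set.Ioc ((g - 3) ^ 2) ((g - 3) ^ 2 + 9) =
      (fun x ↦ (g - 3) ^ 2 + x) '' (Set.Icc 1 6 ∪ {9}) := by
  rw [picardNumbers_inter_Ioc_thirdBox hg, picardNumbers_three]

/-- **The top of `R_g` for `g ≥ 12`, fully explicit**:
`R_g ∩ [(g−3)² + 1, g²] = ((g−3)² + {1, …, 6, 9}) ∪ ((g−2)² + {1, 2, 3, 4}) ∪ {(g−1)² + 1} ∪ {g²}`.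
[cite: HulekLaface2019PicardNumbersAV, §7.2 Thm. 7.4 (boxes `R_{g,k} = (g−k)² + R_k`, `k ≤ 3`) with §1 (`R_1`, `R_2`, `R_3`)] -/
theorem picardNumbers_inter_Icc_eq_boxes_explicit {g : ℕ} (hg : 12 ≤ g) :
    picardNumbers g ∩ Set.Icc ((g - 3) ^ 2 + 1) (g ^ 2) =
      (fun x ↦ (g - 3) ^ 2 + x) '' (Set.Icc 1 6 ∪ {9}) ∪
        (fun x ↦ (g - 2) ^ 2 + x) '' ({1, 2, 3, 4} : Set ℕ) ∪
          (fun x ↦ (g - 1) ^ 2 + x) '' ({1} : Set ℕ) ∪ {g ^ 2} := by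
  rw [picardNumbers_inter_Icc_eq_boxes hg, picardNumbers_three, picardNumbers_two, picardNumbers_one]

end PicardNumbers

end ComplexTorus

end Literature.Geometry.Kaehler

end
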